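import Summits.ResolutionOfSingularities.ResolutionOfSingularities.Theorems.EquisingularLiftEquisingularLiftNatPlaneCurveTwistedSplit
import Summits.ResolutionOfSingularities.ResolutionOfSingularities.Theorems.EquisingularLiftEquisingularLiftNatDirStepUnobsOfCharts
import Literature.AlgebraicGeometry.Motives.HypersurfaceCharts
import Literature.AlgebraicGeometry.Motives.ProjectiveClosedSetsForms
import Literature.AlgebraicGeometry.Resolution.ProjectiveSpaceRegular
import HarnessLib

/-!
# [OURS · L1 W4.5(b) · EL♮(3) · NEST host kit, part 3c (charts)] Plane curves in `ℙ²_k`: the charts `D₊(X₁)`, `D₊(X₂)`, the chart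
# equations `F/Xᵢ^d` (non-zero-divisors generating the reduced curve's ideal when radical) and `V₊(F) ⊆ D₊(X₁) ∪ D₊(X₂)`
# — chart LEMMAS only (no `DirStepUnobs` theorem in this file)

Crux chain w45b (cell `res-hironaka`, LADDER-RESOLUTION rung L, slot W4.5(b)), child EL♮(3) = stmt-ResolutionOfSingularities-20148;
WIDTH TABLE D3 «NEST» (desk RULING R39 (i), D3-7 producer res-L1-w45b-nose-w1 ✓ `…NatDirStepUnobsOfCharts`, D3-8 conic res-L1-w45b-iso-w4,
D3-10 / (U-plane) / (K-split) this seat ✓ `…NatDirStepUnobsHostChange` · `…NatFreshPlaneProj` · `…NatPlaneChartsAwayMk` · `…NatPlaneCurveTwistedSplit`).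
res-L1-w45b-iso-w2 g2 (WIDTH seat D-0157 DOOR 1), `--supports stmt-ResolutionOfSingularities-20148 --as helper`.  OURS; NOT a statement of any
manuscript; AI-written, weaker than expert review.  No `sorry`; standard axioms; DEF-FREE.

WHAT — exactly the 11 theorems of this file (namespace `…Sections.PlaneCurveSplit`; `ℙ²_k = Proj k[X₀,X₁,X₂]`, charts `D₊(X₁)`, `D₊(X₂)` =
the tree's `SmoothHypersurface.coordChartOpen k 1 / 2`, chart equations `SmoothHypersurface.chartEqn F i hF = F/Xᵢ^d`):
* plumbing (the pattern of res-L1-w45b-iso-w4's D3-8 file, charts `1, 2`): `inf_chart_le`, `basicOpen_mul_le_inf_chart`, `isAffineOpen_inf_chart`,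
  `res₁_awayToSection`, `res₂_awayToSection` (Mathlib `Proj.awayMap_awayToSection`), `surjective_res_awayToSection₁₂`;
* `chartEqn_eq_mk`, `eq_zero_of_chartEqn_mul_eq_zero` (`F/Xᵢ^d` is a non-zero-divisor, `F ≠ 0`), `isQuasiRegular_chartEqn`,
  `span_chartEqn_eq_ideal` (radical `(F/Xᵢ^d)` ⇒ it IS the ideal of the reduced curve on the chart: the tree's `idealSheaf_ideal_coordChartOpen`),
  `X_one_notMem_or_X_two_notMem` (unit `X₀^d`-coefficient ⇒ `V₊(F) ⊆ D₊(X₁) ∪ D₊(X₂)`).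

NOT HERE (part 3c-b, file `…NatPlaneCurveUnobs`, a separate proposal — nothing below proves a `DirStepUnobs` statement): the transition
`awayMap_chartEqn_one_eq` (`F/X₁^d = (X₂/X₁)^d · F/X₂^d`), `res_chartEqn_one_mem`, `transition_sections`, `twisted_splitting_sections` and the
certificate `dirStepUnobs_planeCurve` (`DirStepUnobs ℙ²_k univ _ V₊(F) _` under the hypotheses `0 < d`, unit `X₀^d`-coefficient, radical chart
equations), which feeds res-L1-w45b-nose-w1's producer `dirStepUnobs_univ_of_two_charts` with the data of THIS file.  Why the hypotheses appear
here already (by type): `hu` (unit `X₀^d`-coefficient) is what `X_one_notMem_or_X_two_notMem` needs (without it the two charts need not cover the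
curve: `F = X₁X₂`); `hrad` is what `span_chartEqn_eq_ideal` needs (non-reduced equations do not generate the REDUCED curve's ideal); `hd : 0 < d`
feeds `idealSheaf_ideal_coordChartOpen`.  HONEST SCOPE: model-level lemmas on `ℙ²_k`; counted 0; EL♮(3) is NOT proved; resolution in
characteristic `p` is NOT proved here (dim 3 is Cossart–Piltant 2008/2009 in print).

References (index only): R. Hartshorne, *Algebraic Geometry* (1977), II Prop. 2.5, II Example 3.2.6, III Thm. 5.1 [cite: Hartshorne1977];
The Stacks Project, Tag 01ED [cite: StacksProject].
-/

set_option linter.dupNamespace false -- mandated namespace `Summit.<Summit>.<Problem>` of this single-conjunct summit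

noncomputable section

-- `TopCat.Presheaf`/`Scheme.Modules` are not reducible (as in Mathlib's `AlgebraicGeometry/Modules`).
set_option backward.isDefEq.respectTransparency false

open CategoryTheory AlgebraicGeometry Opposite TopologicalSpace MvPolynomial HomogeneousLocalization
open Literature.AlgebraicGeometry.Motives Literature.AlgebraicGeometry.Motives.ProjectiveSpace

attribute [local instance] MvPolynomial.gradedAlgebra ProjBaseChange.algebraBase

namespace Summit.ResolutionOfSingularities.ResolutionOfSingularities.Cruxes.EquisingularLiftNat.Sections

namespace PlaneCurveSplit

variable (k : Type) [Field k]

/-! ### The two charts `D₊(X₁)`, `D₊(X₂)` of `ℙ²_k` and their overlap `D₊(X₁X₂)` -/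

/-- `D₊(X₁) ∩ D₊(X₂) ≤ D₊(X₁X₂)` (Mathlib `Proj.basicOpen_mul`). [folklore] -/
theorem inf_chart_le :
    ((SmoothHypersurface.coordChartOpen (n := 1) k 1 : (Proj (homogeneousSubmodule (Fin 3) k)).Opens) ⊓
        (SmoothHypersurface.coordChartOpen (n := 1) k 2 : (Proj (homogeneousSubmodule (Fin 3) k)).Opens)) ≤
      Proj.basicOpen (homogeneousSubmodule (Fin 3) k) (X 1 * X 2) :=
  (Proj.basicOpen_mul (homogeneousSubmodule (Fin 3) k) (X 1) (X 2)).ge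

/-- `D₊(X₁X₂) ≤ D₊(X₁) ∩ D₊(X₂)`. [folklore] -/
theorem basicOpen_mul_le_inf_chart :
    Proj.basicOpen (homogeneousSubmodule (Fin 3) k) (X 1 * X 2) ≤
      ((SmoothHypersurface.coordChartOpen (n := 1) k 1 : (Proj (homogeneousSubmodule (Fin 3) k)).Opens) ⊓
        (SmoothHypersurface.coordChartOpen (n := 1) k 2 : (Proj (homogeneousSubmodule (Fin 3) k)).Opens)) :=
  (Proj.basicOpen_mul (homogeneousSubmodule (Fin 3) k) (X 1) (X 2)).le

/-- The overlap `D₊(X₁) ∩ D₊(X₂) = D₊(X₁X₂)` is affine. [folklore] -/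
theorem isAffineOpen_inf_chart :
    IsAffineOpen (((SmoothHypersurface.coordChartOpen (n := 1) k 1 : (Proj (homogeneousSubmodule (Fin 3) k)).Opens) ⊓
      (SmoothHypersurface.coordChartOpen (n := 1) k 2 : (Proj (homogeneousSubmodule (Fin 3) k)).Opens))) := by
  rw [le_antisymm (inf_chart_le k) (basicOpen_mul_le_inf_chart k)]
  exact Proj.isAffineOpen_basicOpen _ _ (X_one_mul_X_two_mem k) two_pos

/-- Restriction `Γ(D₊(X₁)) → Γ(D₊(X₁) ∩ D₊(X₂))` of `a/X₁ⁿ` is `awayMap` (`a X₂ⁿ/(X₁X₂)ⁿ`) read through `Γ(D₊(X₁X₂))`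
(Mathlib `Proj.awayMap_awayToSection`). [folklore] -/
theorem res₁_awayToSection (z : Away (homogeneousSubmodule (Fin 3) k) (X 1 : MvPolynomial (Fin 3) k)) :
    (Proj (homogeneousSubmodule (Fin 3) k)).presheaf.map (homOfLE (inf_le_left :
        ((SmoothHypersurface.coordChartOpen (n := 1) k 1 : (Proj (homogeneousSubmodule (Fin 3) k)).Opens) ⊓
          (SmoothHypersurface.coordChartOpen (n := 1) k 2 : (Proj (homogeneousSubmodule (Fin 3) k)).Opens)) ≤
        (SmoothHypersurface.coordChartOpen (n := 1) k 1 : (Proj (homogeneousSubmodule (Fin 3) k)).Opens))).op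
        ((Proj.awayToSection (homogeneousSubmodule (Fin 3) k) (X 1)).hom z) =
      (Proj (homogeneousSubmodule (Fin 3) k)).presheaf.map (homOfLE (inf_chart_le k)).op
        ((Proj.awayToSection (homogeneousSubmodule (Fin 3) k) (X 1 * X 2)).hom
          (awayMap (homogeneousSubmodule (Fin 3) k) (X_two_mem k) (rfl : (X 1 * X 2 : MvPolynomial (Fin 3) k) = X 1 * X 2) z)) := by
  have h := Proj.awayMap_awayToSection (homogeneousSubmodule (Fin 3) k) (X_two_mem k)
    (rfl : (X 1 * X 2 : MvPolynomial (Fin 3) k) = X 1 * X 2)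
  have h' := congrArg (fun φ => (φ ≫ (Proj (homogeneousSubmodule (Fin 3) k)).presheaf.map (homOfLE (inf_chart_le k)).op).hom z) h
  simp only [Category.assoc, ← Functor.map_comp, ← op_comp] at h'
  exact h'.symm

/-- The same for the chart `D₊(X₂)`. [folklore] -/
theorem res₂_awayToSection (z : Away (homogeneousSubmodule (Fin 3) k) (X 2 : MvPolynomial (Fin 3) k)) :
    (Proj (homogeneousSubmodule (Fin 3) k)).presheaf.map (homOfLE (inf_le_right :
        ((SmoothHypersurface.coordChartOpen (n := 1) k 1 : (Proj (homogeneousSubmodule (Fin 3) k)).Opens) ⊓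
          (SmoothHypersurface.coordChartOpen (n := 1) k 2 : (Proj (homogeneousSubmodule (Fin 3) k)).Opens)) ≤
        (SmoothHypersurface.coordChartOpen (n := 1) k 2 : (Proj (homogeneousSubmodule (Fin 3) k)).Opens))).op
        ((Proj.awayToSection (homogeneousSubmodule (Fin 3) k) (X 2)).hom z) =
      (Proj (homogeneousSubmodule (Fin 3) k)).presheaf.map (homOfLE (inf_chart_le k)).op
        ((Proj.awayToSection (homogeneousSubmodule (Fin 3) k) (X 1 * X 2)).hom
          (awayMap (homogeneousSubmodule (Fin 3) k) (X_one_mem k) (mul_comm (X 1 : MvPolynomial (Fin 3) k) (X 2)) z)) := by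
  have h := Proj.awayMap_awayToSection (homogeneousSubmodule (Fin 3) k) (X_one_mem k)
    (mul_comm (X 1 : MvPolynomial (Fin 3) k) (X 2))
  have h' := congrArg (fun φ => (φ ≫ (Proj (homogeneousSubmodule (Fin 3) k)).presheaf.map (homOfLE (inf_chart_le k)).op).hom z) h
  simp only [Category.assoc, ← Functor.map_comp, ← op_comp] at h'
  exact h'.symm

/-- `(k[X]_{(X₁X₂)})₀ → Γ(D₊(X₁X₂)) → Γ(D₊(X₁) ∩ D₊(X₂))` is onto. [folklore] -/
theorem surjective_res_awayToSection₁₂ :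
    Function.Surjective (((Proj (homogeneousSubmodule (Fin 3) k)).presheaf.map (homOfLE (inf_chart_le k)).op).hom.comp
      (Proj.awayToSection (homogeneousSubmodule (Fin 3) k) (X 1 * X 2)).hom) := by
  intro s
  obtain ⟨z, hz⟩ := (Proj.basicOpenIsoAway (homogeneousSubmodule (Fin 3) k) (X 1 * X 2) (X_one_mul_X_two_mem k)
    two_pos).commRingCatIsoToRingEquiv.surjective
    ((Proj (homogeneousSubmodule (Fin 3) k)).presheaf.map (homOfLE (basicOpen_mul_le_inf_chart k)).op s)
  refine ⟨z, ?_⟩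
  have hz' : (Proj.awayToSection (homogeneousSubmodule (Fin 3) k) (X 1 * X 2)).hom z =
      (Proj (homogeneousSubmodule (Fin 3) k)).presheaf.map (homOfLE (basicOpen_mul_le_inf_chart k)).op s := by
    rw [← hz]; rfl
  rw [RingHom.comp_apply, hz', ← CommRingCat.comp_apply, ← Functor.map_comp, ← op_comp]
  have hid : (homOfLE (inf_chart_le k) ≫ homOfLE (basicOpen_mul_le_inf_chart k) :
      ((SmoothHypersurface.coordChartOpen (n := 1) k 1 : (Proj (homogeneousSubmodule (Fin 3) k)).Opens) ⊓
        (SmoothHypersurface.coordChartOpen (n := 1) k 2 : (Proj (homogeneousSubmodule (Fin 3) k)).Opens)) ⟶ _) = 𝟙 _ :=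
    Subsingleton.elim _ _
  rw [hid, op_id, CategoryTheory.Functor.map_id]
  rfl

/-! ### The chart equations `F/X₁^d`, `F/X₂^d` of a plane curve -/

section Curve

variable {k} {d : ℕ} (F : MvPolynomial (Fin 3) k) (hF : F.IsHomogeneous d)

/-- The chart equation `chartEqn F i = F/Xᵢ^d` as an `Away.mk` fraction. [folklore] -/
theorem chartEqn_eq_mk (i : Fin 3) :
    SmoothHypersurface.chartEqn F i hF =
      Away.mk (homogeneousSubmodule (Fin 3) k) (X_mem (R := k) (n := 2) i) d F
        (by rw [smul_eq_mul, mul_one]; exact (mem_homogeneousSubmodule d F).mpr hF) := by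
  refine away_mk_eq_mk _ _ _ _ _ ?_
  rw [pow_one]

/-- `F/Xᵢ^d` is a non-zero-divisor of `(k[X]_{Xᵢ})₀` when `F ≠ 0` (`k[X₀,X₁,X₂]` is a domain). [folklore] -/
theorem eq_zero_of_chartEqn_mul_eq_zero (hF0 : F ≠ 0) (i : Fin 3)
    (z : Away (homogeneousSubmodule (Fin 3) k) (X i : MvPolynomial (Fin 3) k))
    (hz : SmoothHypersurface.chartEqn F i hF * z = 0) : z = 0 := by
  obtain ⟨m, a, ha, rfl⟩ := Away.mk_surjective _ (X_mem (R := k) (n := 2) i) z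
  rw [chartEqn_eq_mk, away_mk_mul] at hz
  have hval := congrArg HomogeneousLocalization.val hz
  rw [Away.val_mk, val_zero, ← Localization.mk_zero (1 : Submonoid.powers (X i : MvPolynomial (Fin 3) k)),
    Localization.mk_eq_mk_iff, Localization.r_iff_exists] at hval
  obtain ⟨⟨c, ⟨e, rfl⟩⟩, hc⟩ := hval
  simp only [OneMemClass.coe_one, one_mul, mul_zero] at hc
  have hFa : F * a = 0 := by
    rcases mul_eq_zero.mp hc with h | h
    · exact absurd (eq_zero_of_pow_eq_zero h) (X_ne_zero i)
    · exact h
  have ha0 : a = 0 := by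
    rcases mul_eq_zero.mp hFa with h | h
    · exact absurd h hF0
    · exact h
  subst ha0
  exact away_mk_zero _ _ m

/-- The one-element family `F/Xᵢ^d` of sections over `D₊(Xᵢ)` is quasi-regular (a non-zero-divisor). [folklore] -/
theorem isQuasiRegular_chartEqn (hF0 : F ≠ 0) (i : Fin 3) :
    Literature.AlgebraicGeometry.Resolution.IsQuasiRegular
      (fun _ : Fin 1 => (Proj.awayToSection (homogeneousSubmodule (Fin 3) k) (X i)).hom (SmoothHypersurface.chartEqn F i hF)) := by
  refine Literature.AlgebraicGeometry.Resolution.isQuasiRegular_of_regularSeq 1 _ fun j y hy => ?_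
  have hIio : (fun _ : Fin 1 => (Proj.awayToSection (homogeneousSubmodule (Fin 3) k) (X i)).hom
      (SmoothHypersurface.chartEqn F i hF)) '' Set.Iio j = ∅ := by
    rw [Set.image_eq_empty]; ext j'; simp [Subsingleton.elim j' j]
  rw [hIio, Ideal.span_empty, Ideal.mem_bot] at hy ⊢
  obtain ⟨y', rfl⟩ := (SmoothHypersurface.awayEquivSections (k := k) i).surjective y
  rw [← SmoothHypersurface.awayEquivSections_apply, ← map_mul,
    map_eq_zero_iff _ (SmoothHypersurface.awayEquivSections i).injective] at hy
  rw [eq_zero_of_chartEqn_mul_eq_zero F hF hF0 i y' hy, map_zero]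

/-- On `D₊(Xᵢ)` the chart equation GENERATES the ideal of the reduced curve `V₊(F)` as soon as `(F/Xᵢ^d)` is a RADICAL ideal of the chart
ring (the tree's `idealSheaf_ideal_coordChartOpen` = Nullstellensatz on the chart). [cite: Hartshorne1977, II Example 3.2.6] -/
theorem span_chartEqn_eq_ideal (hd : 0 < d) (i : Fin 3)
    (hrad : (Ideal.span {SmoothHypersurface.chartEqn F i hF}).IsRadical) :
    Ideal.span {(Proj.awayToSection (homogeneousSubmodule (Fin 3) k) (X i)).hom (SmoothHypersurface.chartEqn F i hF)} =
      (SmoothHypersurface.idealSheaf F).ideal (SmoothHypersurface.coordChartOpen k i) := by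
  rw [SmoothHypersurface.idealSheaf_ideal_coordChartOpen _ i hF hd, SmoothHypersurface.chartIdeal, hrad.radical, Ideal.map_span,
    Set.image_singleton]

/-- The curve misses the point `(1:0:0)` when the `X₀^d`-coefficient of `F` is a unit: a relevant homogeneous prime containing `F` omits
`X₁` or `X₂` (pure algebra; the scheme reading `V₊(F) ⊆ D₊(X₁) ∪ D₊(X₂)` is taken in the final assembly). [folklore] -/
theorem X_one_notMem_or_X_two_notMem (hF : F.IsHomogeneous d) (hu : IsUnit (coeff (Finsupp.single 0 d) F))
    (q : ProjectiveSpectrum (homogeneousSubmodule (Fin 3) k)) (hp : F ∈ q.asHomogeneousIdeal) :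
    (X 1 : MvPolynomial (Fin 3) k) ∉ q.asHomogeneousIdeal ∨ (X 2 : MvPolynomial (Fin 3) k) ∉ q.asHomogeneousIdeal := by
  classical
  by_contra h
  rw [not_or, not_not, not_not] at h
  obtain ⟨hx1, hx2⟩ := h
  -- `F' := F − u X₀^d` lies in `q` (all its monomials contain `X₁` or `X₂`), hence so does `u X₀^d`, hence `X₀`
  obtain ⟨u, hu⟩ := hu
  have hsF : (F - C (u : k) * X 0 ^ d).IsHomogeneous d := by
    have h1 : (C (u : k) * X 0 ^ d : MvPolynomial (Fin 3) k).IsHomogeneous d := by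
      simpa using (isHomogeneous_C (Fin 3) (u : k)).mul ((isHomogeneous_X k (0 : Fin 3)).pow d)
    exact hF.sub h1
  have hmono : ∀ s ∈ (F - C (u : k) * X 0 ^ d).support,
      (monomial s (coeff s (F - C (u : k) * X 0 ^ d)) : MvPolynomial (Fin 3) k) ∈ q.asHomogeneousIdeal := by
    intro s hs
    have hdeg := support_degree_eq hsF s hs
    have hs0 : s 0 < d := by
      by_contra hlt
      have h0 : s 0 = d := by omega
      have hseq : s = Finsupp.single 0 d := by
        ext j
        fin_cases j
        · simpa using h0
        · show s 1 = (Finsupp.single (0 : Fin 3) d) 1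
          rw [Finsupp.single_eq_of_ne (by decide)]; omega
        · show s 2 = (Finsupp.single (0 : Fin 3) d) 2
          rw [Finsupp.single_eq_of_ne (by decide)]; omega
      rw [mem_support_iff, hseq, coeff_sub, coeff_C_mul, coeff_X_pow, if_pos rfl, ← hu, mul_one, sub_self] at hs
      exact hs rfl
    rw [monomial_eq_C_mul_X_pow]
    rcases Nat.eq_zero_or_pos (s 1) with h1' | h1'
    · -- then `s 2 > 0`
      have h2' : 0 < s 2 := by omega
      obtain ⟨t, ht⟩ := Nat.exists_eq_add_of_lt h2'
      rw [ht, zero_add, pow_succ, ← mul_assoc]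
      exact Ideal.mul_mem_left _ _ hx2
    · obtain ⟨t, ht⟩ := Nat.exists_eq_add_of_lt h1'
      have e : (C (coeff s (F - C (u : k) * X 0 ^ d)) * X 0 ^ s 0 * X 1 ^ (0 + t + 1) * X 2 ^ s 2 : MvPolynomial (Fin 3) k) =
          (C (coeff s (F - C (u : k) * X 0 ^ d)) * X 0 ^ s 0 * X 1 ^ t * X 2 ^ s 2) * X 1 := by ring
      rw [ht, e]
      exact Ideal.mul_mem_left _ _ hx1
  have hF' : F - C (u : k) * X 0 ^ d ∈ q.asHomogeneousIdeal := by
    have hsum := (F - C (u : k) * X 0 ^ d).as_sum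
    have hmem : (∑ s ∈ (F - C (u : k) * X 0 ^ d).support, monomial s (coeff s (F - C (u : k) * X 0 ^ d)) :
        MvPolynomial (Fin 3) k) ∈ q.asHomogeneousIdeal := Ideal.sum_mem _ hmono
    exact hsum ▸ hmem
  have hX0d : C (u : k) * (X 0 : MvPolynomial (Fin 3) k) ^ d ∈ q.asHomogeneousIdeal := by
    have := Ideal.sub_mem _ hp hF'
    rwa [sub_sub_cancel] at this
  have hX0 : (X 0 : MvPolynomial (Fin 3) k) ∈ q.asHomogeneousIdeal := by
    have hCu : IsUnit (C (u : k) : MvPolynomial (Fin 3) k) := (Units.isUnit u).map C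
    have h' := (Ideal.unit_mul_mem_iff_mem _ hCu).mp hX0d
    exact q.isPrime.mem_of_pow_mem d h'
  obtain ⟨j, hj⟩ := exists_X_notMem (k := k) (n := 2) q
  fin_cases j
  · exact hj hX0
  · exact hj hx1
  · exact hj hx2

end Curve

end PlaneCurveSplit

end Summit.ResolutionOfSingularities.ResolutionOfSingularities.Cruxes.EquisingularLiftNat.Sections

end
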